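/- Copyright: the b2b-balaban cell (near-miss cell 7), T⁴-continuum fan-out; row NE7b ROUND-2 swarm, seat
t4-ne7b-formalise-leaf-01 (gen 8) (road W-RP, offer «W-E1» — journal INTENT l.17214; owner's table
`t4/b2b-balaban-t4-ne7b-p1/LEAVES-NE7b.md` v3.54: W-E1 := leaf-01 g8).  Released under the licence of the surrounding project. -/
import Summits.QuantumFields.BalabanUV.T4Continuum.Support.HistoryChessboardEventsTower
import Literature.MathematicalPhysics.QuantumFieldTheory.Balaban1983to89.T4StabilitySocket
import Literature.MathematicalPhysics.QuantumFieldTheory.Balaban1983to89.T4Apex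

/-!
# Road W-RP: THE E1∕E2 REPRESENTATION IDENTITIES ARE THEOREMS ON THE GIBBS TOWER

Summits-side support leaf of the T⁴-continuum cell (rung (B)+1 on a FINITE torus only; NOT infinite volume, NOT the
mass gap, NOT the Clay statement; NOT a proof of the spine estimate NE7b).  Row NE7b, road **W-RP** (R-OWNER-23-2 ∕
R-OWNER-23-8), row «W-E1» (owner booking v3.54; leaf-01 gen 8).  [folklore] measure-theoretic bookkeeping (push-forward,
change of variables, finite additivity) over the cell's OWN carriers — W3l's `HistoryRPTowerLaw.Tower`∕`last`∕`towerLaw`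
(p223621), W4c's `HistoryChessboardEventsTower.cutoffParams` (p225060) — and the tree's dictionary `FiniteEpsData.dens` ∕
`Realisation.rho_zero` ∕ `T4GenFunBounds.gibbsMeasure` ∕ `T4StabilitySocket.exists_const_dressedZ`.  No `[cite:]` tag
(nothing printed is stated), no `Prop`-valued fact minted (c1), no constant (c2∕c6), no exit ∕ socket ∕ `HistoryConstants`
file touched (c3); three DATA definitions (`towerPt`, `obsTower`, `Zrun`).

WHY.  Both kernel-complete roads of row NE7b display, per tuned run and loop string, the E1∕E2 REPRESENTATION IDENTITIES
(`ChessboardRoadWitness.reprA∕reprB` p225502 = `CountRoadWitnessT3b.reprA∕reprB` p223239, token for token):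
`∫ e^{t·prodObs_K(os)} ρ₀ dU = Σ_{τ ∈ T K} A K t τ` (run B at `K + 1`); road W displays in addition, per cutoff, W4b′'s
clause `repr : A t τ = Z · ∫_{ev τ} e^{t·obs} dμ` (`CutoffReading` p220032 ∕ `EventSide` p224832).  For road W a term IS
an event of the normalised extended state; this file shows that then E1∕E2 are NOT independent readings: once the state is
the Gibbs TOWER LAW of the data's own averagings, the source observable is the loop product read on the tower's top level and
`Z` is the run's `∫ρ₀`, `reprA` FOLLOWS from `repr` for ANY family of term events that PARTITIONS the tower.

WHAT.  §1 `towerPt av k : U ↦ (U, Ū, …, Ū^k)` (recursion matching W3l's `Tower`), `last_towerPt` (top field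
`= Averaging.iter av k U`), `measurable_towerPt`, **`towerLaw_eq_map : towerLaw μ av k = μ.map (towerPt av k)`**,
`integral_towerLaw`, `isProbabilityMeasure_towerLaw`, `towerLaw_congr_av`.  §2 `obsTower K os` (the loop product of `os` on
the TOP level), **`obsTower_towerPt`** (`= T4GenFunBounds.prodObs (D.scheme g₀) K os U` at the tower point),
`measurable_obsTower`, `abs_obsTower_le_one` (`obs_meas`∕`obs_bdd` with `ob = 1`).  §3 `Zrun D K g := ∫ ρ₀ dU` (`= c·Z_ε > 0`)
and **`integral_exp_mul_prodObs_dens_zero`**: `∫ e^{t·prodObs} · D.dens K (g₀ K) 0 dU = Zrun · ∫ e^{t·obsTower} d(towerLaw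
(gibbsMeasure (F.P K) ((g₀ K)⁻¹ ^ 2)) (D.av K) K)`.  §3b THE BRIDGE TO W4c's TOWERS BY NAME: `P_eq_cutoffParams : F.P K =
cutoffParams (F.P K') K` (`rfl`); under `D.IsBlockAveraged ℰ`: **`towerLaw_isBlockAveraged`** (ONE carrier with W4c's
`EventSide` families at `P₀ := F.P 0`, `ℰA K k := ℰ`, `βA K := (g₀ K)⁻¹ ^ 2`) and **`integral_exp_mul_prodObs_dens_zero_blockAvg`**.
§4 **`sum_repr_eq_of_partition`**, **`reprA_of_repr`** ∕ **`reprB_of_repr`**: for finitely many measurable, pairwise disjoint,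
covering term events on the tower and weights with `repr` relative to `(towerLaw …, Zrun, obsTower)`, the binders
`reprA`∕`reprB` hold VERBATIM (window and threshold unused).  §5 sanity: the one-term partition inhabits the shapes.

HONEST SCOPE (R-OWNER-23-8 wording for road W-RP: the printed, centred 4-d averaging prescription; (RP-ext) displayed as
the covariance reading (γ)).  Census effect: for a W-road witness on the Gibbs towers with `Z := Zrun`, `obs := obsTower`
and PARTITIONING term events (one clause MORE than `CutoffReading` displays — pairwise disjointness of ALL term events, not
only `bad_disj`), `reprA`∕`reprB` are consequences of `repr`.  NOT touched: (EXT) proper — that the terms of Bałaban's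
𝐑-operation expansion ARE such event weights (`repr` for HIS terms; in print they carry 𝐑-operations and analytic
continuations, not bare characteristic functions) —, `ev_cover`, `bad_sub`, (LOC)∕(R-sym), (U1)+(G2) `univ_le`, NE7c, NE7,
the rates; nothing of H3 ∕ (B) ∕ BetaPertH; the count 0∕9 is unchanged.  NE7b NOT proved; spine 0∕9.  HONEST DEPENDENCY
(cell): continuum YM on T⁴ ⇐ BetaPertH ∧ nine spine estimates (0/9 proved); BetaPertH ⇐ (D1) ∧ (D4) ∧ CAP+tail; G-an2-4
gates asym, D1 and NE2/3/4.  This file changes none of it. -/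

open MeasureTheory ProbabilityTheory
open Literature.MathematicalPhysics.QuantumFieldTheory.Balaban1983to89
open Literature.MathematicalPhysics.QuantumFieldTheory.Balaban1983to89.Missing
open Literature.MathematicalPhysics.QuantumFieldTheory.Balaban1983to89.T4Continuum
open Literature.MathematicalPhysics.QuantumFieldTheory.Balaban1983to89.T4GenFunBounds
open Literature.MathematicalPhysics.QuantumFieldTheory.Balaban1983to89.T4StabilitySocket
open Summit.QuantumFields.BalabanUV.T4Continuum.HistoryRPTowerLaw

namespace Summit.QuantumFields.BalabanUV.T4Continuum.HistoryChessboardTowerRepr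

noncomputable section

/-! ## §1 The tower point of a fine configuration; the tower law is its push-forward -/

section TowerPt

variable {P : Params} {G : Type*} [GaugeGroup G]

/-- **THE TOWER POINT** of a fine configuration `U`: `(U, Ū, Ū², …, Ū^k)` — the averaged fields of all levels `≤ k`,
appended one at a time exactly as in W3l's `towerLaw`. -/
def towerPt (av : (j : ℕ) → Averaging P j G) : (k : ℕ) → GaugeField P 0 G → Tower P G k
  | 0 => fun U => U
  | k + 1 => fun U => (towerPt av k U, (av k).avg (last k (towerPt av k U)))

/-- The recursion of `towerPt`, as a composition with W3l's one-step map «append the next average of the top field».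
[folklore] -/
theorem towerPt_succ (av : (j : ℕ) → Averaging P j G) (k : ℕ) :
    towerPt av (k + 1) = (fun ω : Tower P G k => ((ω, (av k).avg (last k ω)) : Tower P G (k + 1))) ∘ towerPt av k :=
  rfl

/-- The top field of the tower point is the `k`-fold average `Ū^k = Averaging.iter av k U`. [folklore] -/
theorem last_towerPt (av : (j : ℕ) → Averaging P j G) :
    ∀ (k : ℕ) (U : GaugeField P 0 G), last k (towerPt av k U) = Averaging.iter av k U
  | 0, _ => rfl
  | k + 1, U => by
    show (av k).avg (last k (towerPt av k U)) = (av k).avg (Averaging.iter av k U)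
    rw [last_towerPt av k U]

variable [MeasurableSpace G]

/-- W3l's one-step map is measurable when the averaging is. [folklore] -/
theorem measurable_step (av : (j : ℕ) → Averaging P j G) (hA : ∀ j, Measurable (av j).avg) (k : ℕ) :
    Measurable (fun ω : Tower P G k => ((ω, (av k).avg (last k ω)) : Tower P G (k + 1))) :=
  measurable_id.prodMk ((hA k).comp (measurable_last k))

/-- The tower point is a measurable function of the fine configuration. [folklore] -/
theorem measurable_towerPt (av : (j : ℕ) → Averaging P j G) (hA : ∀ j, Measurable (av j).avg) :
    ∀ k : ℕ, Measurable (towerPt av k)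
  | 0 => measurable_id
  | k + 1 => (measurable_step av hA k).comp (measurable_towerPt av hA k)

/-- **THE TOWER LAW IS THE PUSH-FORWARD OF THE BASE STATE ALONG THE TOWER POINT**: `towerLaw μ av k = μ.map (towerPt av k)`
— the block variables are DETERMINISTIC functions of the fine field. [folklore] -/
theorem towerLaw_eq_map (μ : Measure (GaugeField P 0 G)) (av : (j : ℕ) → Averaging P j G)
    (hA : ∀ j, Measurable (av j).avg) : ∀ k : ℕ, towerLaw μ av k = μ.map (towerPt av k)
  | 0 => Measure.map_id.symm
  | k + 1 => by
    show (towerLaw μ av k).map (fun ω : Tower P G k => ((ω, (av k).avg (last k ω)) : Tower P G (k + 1))) =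
      μ.map (towerPt av (k + 1))
    rw [towerLaw_eq_map μ av hA k, Measure.map_map (measurable_step av hA k) (measurable_towerPt av hA k)]
    rfl

/-- **CHANGE OF VARIABLES**: integrating against the tower law is integrating the tower-point composite against the base.
[folklore] -/
theorem integral_towerLaw (μ : Measure (GaugeField P 0 G)) (av : (j : ℕ) → Averaging P j G)
    (hA : ∀ j, Measurable (av j).avg) (k : ℕ) {f : Tower P G k → ℝ} (hf : Measurable f) :
    ∫ ω, f ω ∂towerLaw μ av k = ∫ U, f (towerPt av k U) ∂μ := by
  rw [towerLaw_eq_map μ av hA k, integral_map (measurable_towerPt av hA k).aemeasurable hf.aestronglyMeasurable]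

/-- The tower law of a probability state is a probability measure. [folklore] -/
theorem isProbabilityMeasure_towerLaw (μ : Measure (GaugeField P 0 G)) [IsProbabilityMeasure μ]
    (av : (j : ℕ) → Averaging P j G) (hA : ∀ j, Measurable (av j).avg) (k : ℕ) :
    IsProbabilityMeasure (towerLaw μ av k) := by
  rw [towerLaw_eq_map μ av hA k]
  exact Measure.isProbabilityMeasure_map (measurable_towerPt av hA k).aemeasurable

/-- The tower law depends on the averagings only through their values (pointwise-equal families give the same law).
[folklore] -/
theorem towerLaw_congr_av (μ : Measure (GaugeField P 0 G)) {av av' : (j : ℕ) → Averaging P j G}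
    (h : ∀ j, (av j).avg = (av' j).avg) : ∀ k : ℕ, towerLaw μ av k = towerLaw μ av' k
  | 0 => rfl
  | k + 1 => by
    show (towerLaw μ av k).map (fun ω : Tower P G k => ((ω, (av k).avg (last k ω)) : Tower P G (k + 1))) =
      (towerLaw μ av' k).map (fun ω : Tower P G k => ((ω, (av' k).avg (last k ω)) : Tower P G (k + 1)))
    rw [towerLaw_congr_av μ h k, h k]

end TowerPt

/-! ## §2 The loop product of a string read on the top level of the tower -/

section Obs

variable {F : T4Family} {G : Type*} [GaugeGroup G]

/-- **THE SOURCE OBSERVABLE OF A LOOP STRING ON THE TOWER** of cutoff `K`: the product of the unit-scale loop variables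
of the labels `os`, read on the TOP field `Ū^K` of the tower point. -/
def obsTower (K : ℕ) (os : List (ULoop F)) : Tower (F.P K) G K → ℝ :=
  fun ω => (os.map fun C => loopAt (last K ω) (C.1.atLevel K)).prod

variable [MeasurableSpace G] [HaarData G]

/-- **READ AT THE TOWER POINT, THE TOWER OBSERVABLE IS THE APEX'S E1 OBSERVABLE** `prodObs (D.scheme g₀) K os`
(the product of the data's averaged loop variables `D.avgObs K C`). [folklore] -/
theorem obsTower_towerPt (D : FiniteEpsData F G) (g₀ : ℕ → ℝ) (K : ℕ) (os : List (ULoop F))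
    (U : GaugeField (F.P K) 0 G) :
    obsTower K os (towerPt (D.av K) K U) = T4GenFunBounds.prodObs (D.scheme g₀) K os U := by
  show (os.map fun C => loopAt (last K (towerPt (D.av K) K U)) (C.1.atLevel K)).prod =
    (os.map fun C => D.avgObs K C U).prod
  rw [last_towerPt]
  rfl

variable [RegularGaugeGroup G]

omit [HaarData G] in
/-- The tower observable is measurable. [folklore] -/
theorem measurable_obsTower (K : ℕ) : ∀ os : List (ULoop F), Measurable (obsTower (G := G) K os)
  | [] => by
    show Measurable fun ω : Tower (F.P K) G K =>
      (List.map (fun C : ULoop F => loopAt (last K ω) (C.1.atLevel K)) []).prod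
    simp only [List.map_nil, List.prod_nil]
    exact measurable_const
  | C :: os => by
    have h : obsTower (G := G) K (C :: os) =
        fun ω => loopAt (last K ω) (C.1.atLevel K) * obsTower (G := G) K os ω := by
      funext ω
      simp only [obsTower, List.map_cons, List.prod_cons]
    rw [h]
    exact ((measurable_loopAt (C.1.atLevel K)).comp (measurable_last K)).mul (measurable_obsTower K os)

omit [HaarData G] in
/-- The tower observable is bounded by `1` (loop variables are `Re tr ∕ N`). [folklore] -/
theorem abs_obsTower_le_one (K : ℕ) : ∀ (os : List (ULoop F)) (ω : Tower (F.P K) G K), |obsTower K os ω| ≤ 1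
  | [], ω => by simp [obsTower]
  | C :: os, ω => by
    have h : obsTower (G := G) K (C :: os) ω = loopAt (last K ω) (C.1.atLevel K) * obsTower (G := G) K os ω := by
      simp only [obsTower, List.map_cons, List.prod_cons]
    rw [h, abs_mul]
    exact mul_le_one₀ (abs_loopAt_le_one _ _) (abs_nonneg _) (abs_obsTower_le_one K os ω)

end Obs

/-! ## §3 The level-0 density of a run against the Gibbs tower: E1 as a theorem -/

section EOne

variable {F : T4Family} {G : Type*} [GaugeGroup G] [MeasurableSpace G] [HaarData G]

/-- **THE RUN'S UNDRESSED PARTITION FUNCTION IN BAŁABAN'S NORMALISATION**: `∫ ρ₀ dU` on the `K`-th torus at bare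
coupling `g` (`= c · Z_ε`, `T4StabilitySocket.exists_const_dressedZ`). -/
def Zrun (D : FiniteEpsData F G) (K : ℕ) (g : ℝ) : ℝ :=
  ∫ U, D.dens K g 0 U ∂fieldMeasure (F.P K) 0 G

/-- `Zrun = c · Z_ε` with the run's constant `c > 0` of `rho_zero`, and the dressed integral of `ρ₀` is `c ·` the
Wilson-normalised dressed partition function — both with THE SAME `c`. [folklore] -/
theorem exists_const_Zrun (D : FiniteEpsData F G) (K : ℕ) (g : ℝ) :
    ∃ c : ℝ, 0 < c ∧ Zrun D K g = c * partitionFn (G := G) (F.P K) (g⁻¹ ^ 2) ∧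
      ∀ (obs : GaugeField (F.P K) 0 G → ℝ) (t : ℝ),
        ∫ U, Real.exp (t * obs U) * D.dens K g 0 U ∂fieldMeasure (F.P K) 0 G =
          c * T4GenFunBounds.dressedZ (F.P K) (g⁻¹ ^ 2) obs t := by
  obtain ⟨c, hc, -, h⟩ := exists_const_dressedZ D K g
  refine ⟨c, hc, ?_, h⟩
  have h0 := h (fun _ => 0) 0
  simp only [mul_zero, Real.exp_zero, one_mul] at h0
  rw [Zrun, h0, T4GenFunBounds.dressedZ_zero]

variable [RegularGaugeGroup G]

/-- `Zrun > 0`. [folklore] -/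
theorem Zrun_pos (D : FiniteEpsData F G) (K : ℕ) (g : ℝ) : 0 < Zrun D K g := by
  obtain ⟨c, hc, hZ, -⟩ := exists_const_Zrun D K g
  rw [hZ]
  exact mul_pos hc (partitionFn_pos' (G := G) (F.P K) (sq_nonneg _))

/-- **THE DRESSED INTEGRAL OF `ρ₀` IS `Zrun ·` THE GIBBS EXPECTATION** of the dressing, for every source observable.
[folklore] -/
theorem integral_exp_mul_dens_zero (D : FiniteEpsData F G) (K : ℕ) (g : ℝ) (obs : GaugeField (F.P K) 0 G → ℝ) (t : ℝ) :
    ∫ U, Real.exp (t * obs U) * D.dens K g 0 U ∂fieldMeasure (F.P K) 0 G =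
      Zrun D K g * ∫ U, Real.exp (t * obs U) ∂T4GenFunBounds.gibbsMeasure (F.P K) (g⁻¹ ^ 2) := by
  obtain ⟨c, hc, hZ, h⟩ := exists_const_Zrun D K g
  rw [h obs t, hZ, T4GenFunBounds.dressedZ_eq_partitionFn_mul_mgf (F.P K) (sq_nonneg _) obs t, mgf, mul_assoc]

/-- **E1 ON THE GIBBS TOWER.**  For every datum, cutoff `K`, bare couplings `g₀` and loop string `os`: the
Bałaban-normalised dressed integral of `ρ₀` against the apex's observable — the LEFT side of `reprA` — is `Zrun ·` the
expectation of `e^{t·obsTower}` under the TOWER LAW of the Wilson–Gibbs state at `β_K = (g₀ K)⁻²` along the data's own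
averagings `D.av K`.  (Measurable averagings: the tree's named hypothesis `D.AvgMeasurable`.) [folklore] -/
theorem integral_exp_mul_prodObs_dens_zero (D : FiniteEpsData F G) (hM : D.AvgMeasurable) (g₀ : ℕ → ℝ) (K : ℕ)
    (os : List (ULoop F)) (t : ℝ) :
    ∫ U, Real.exp (t * T4GenFunBounds.prodObs (D.scheme g₀) K os U) * D.dens K (g₀ K) 0 U ∂fieldMeasure (F.P K) 0 G =
      Zrun D K (g₀ K) *
        ∫ ω, Real.exp (t * obsTower K os ω)
          ∂towerLaw (T4GenFunBounds.gibbsMeasure (F.P K) ((g₀ K)⁻¹ ^ 2)) (D.av K) K := by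
  rw [integral_exp_mul_dens_zero D K (g₀ K) _ t,
    integral_towerLaw _ (D.av K) (hM K) K ((measurable_obsTower K os).const_mul t).exp]
  simp only [obsTower_towerPt D g₀ K os]

/-- The same with the tower of ANY pointwise-equal family of averagings (e.g. `fun _ => blockAvg ℰ` under
`D.IsBlockAveraged ℰ`, whose defining clause is `∀ K j, D.av K j = blockAvg ℰ`). [folklore] -/
theorem integral_exp_mul_prodObs_dens_zero_congr_av (D : FiniteEpsData F G) (hM : D.AvgMeasurable) (g₀ : ℕ → ℝ) (K : ℕ)
    {av : (j : ℕ) → Averaging (F.P K) j G} (hav : ∀ j, D.av K j = av j) (os : List (ULoop F)) (t : ℝ) :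
    ∫ U, Real.exp (t * T4GenFunBounds.prodObs (D.scheme g₀) K os U) * D.dens K (g₀ K) 0 U ∂fieldMeasure (F.P K) 0 G =
      Zrun D K (g₀ K) *
        ∫ ω, Real.exp (t * obsTower K os ω) ∂towerLaw (T4GenFunBounds.gibbsMeasure (F.P K) ((g₀ K)⁻¹ ^ 2)) av K := by
  rw [integral_exp_mul_prodObs_dens_zero D hM g₀ K os t, towerLaw_congr_av _ (fun j => by rw [hav j]) K]

end EOne

/-! ## §3b The bridge to W4c's cutoff towers, by name -/

section Bridge

open BlockAveraging
open Summit.QuantumFields.BalabanUV.T4Continuum.HistoryChessboardEventsTower (cutoffParams)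

variable {F : T4Family} {G : Type*} [GaugeGroup G] [MeasurableSpace G] [HaarData G]

/-- **THE `K`-TH TORUS OF A `T4Family` IS W4c's CUTOFF FAMILY OVER ANY OF ITS MEMBERS**: `F.P K = cutoffParams (F.P K') K`
(`d = 4`, `L`, `m` fixed; only the number of RG steps varies) — definitionally. [folklore] -/
theorem P_eq_cutoffParams (F : T4Family) (K K' : ℕ) : F.P K = cutoffParams (F.P K') K := rfl

/-- **ONE CARRIER WITH W4c**: for (0.4)-block-averaged data (`D.IsBlockAveraged ℰ : ∀ K j, D.av K j = blockAvg ℰ`) the tower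
law of the data's own averagings over `F.P K` IS the tower law of `fun k => blockAvg ℰ` over `cutoffParams (F.P 0) K` — the
state of W4c's `EventSide` families (`hybridNE7_of_towerEventSides_SU` with `P₀ := F.P 0`, `ℰA K k := ℰ`) — for every base
state `μ` and every level. [folklore] -/
theorem towerLaw_isBlockAveraged (D : FiniteEpsData F G) {ℰ : LoopAverage G} (hBA : D.IsBlockAveraged ℰ) (K : ℕ)
    (μ : Measure (GaugeField (F.P K) 0 G)) (k : ℕ) :
    towerLaw μ (D.av K) k =
      towerLaw (P := cutoffParams (F.P 0) K) μ (fun j => blockAvg (P := cutoffParams (F.P 0) K) (j := j) ℰ) k :=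
  towerLaw_congr_av μ (fun j => by rw [hBA K j]; rfl) k

variable [RegularGaugeGroup G]

/-- **E1 ON W4c's GIBBS TOWER** for (0.4)-block-averaged data with a measurable small-loop average: the Bałaban-normalised
dressed integral of `ρ₀` is `Zrun ·` the expectation of `e^{t·obsTower}` under
`towerLaw (gibbsMeasure (cutoffParams (F.P 0) K) ((g₀ K)⁻¹ ^ 2)) (fun k => blockAvg ℰ) K`. [folklore] -/
theorem integral_exp_mul_prodObs_dens_zero_blockAvg (D : FiniteEpsData F G) {ℰ : LoopAverage G}
    (hBA : D.IsBlockAveraged ℰ) (hE : ℰ.MeasurableE) (g₀ : ℕ → ℝ) (K : ℕ) (os : List (ULoop F)) (t : ℝ) :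
    ∫ U, Real.exp (t * T4GenFunBounds.prodObs (D.scheme g₀) K os U) * D.dens K (g₀ K) 0 U ∂fieldMeasure (F.P K) 0 G =
      Zrun D K (g₀ K) *
        ∫ ω, Real.exp (t * obsTower K os ω)
          ∂towerLaw (P := cutoffParams (F.P 0) K)
            (T4GenFunBounds.gibbsMeasure (cutoffParams (F.P 0) K) ((g₀ K)⁻¹ ^ 2))
            (fun j => blockAvg (P := cutoffParams (F.P 0) K) (j := j) ℰ) K := by
  rw [integral_exp_mul_prodObs_dens_zero D (hBA.avgMeasurable hE) g₀ K os t, towerLaw_isBlockAveraged D hBA K]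
  rfl

end Bridge

/-! ## §4 From `repr` on the Gibbs tower to `reprA`: term events that partition the tower -/

section Repr

variable {Ω ι : Type*} [MeasurableSpace Ω]

/-- **FINITE ADDITIVITY OVER A PARTITION BY TERM EVENTS**: for finitely many measurable, pairwise disjoint, covering events
and an integrable dressing, the event integrals sum to the total. [folklore] -/
theorem sum_setIntegral_eq_of_partition (μ : Measure Ω) (T : Finset ι) (ev : ι → Set Ω)
    (hmeas : ∀ τ ∈ T, MeasurableSet (ev τ)) (hdisj : (↑T : Set ι).PairwiseDisjoint ev)
    (hcover : Set.univ ⊆ ⋃ τ ∈ T, ev τ) {f : Ω → ℝ} (hf : Integrable f μ) :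
    ∑ τ ∈ T, ∫ ω in ev τ, f ω ∂μ = ∫ ω, f ω ∂μ := by
  rw [← integral_biUnion_finset T hmeas hdisj (fun τ _ => hf.integrableOn),
    Set.eq_univ_of_univ_subset hcover, Measure.restrict_univ]

variable {F : T4Family} {G : Type*} [GaugeGroup G] [MeasurableSpace G] [HaarData G] [RegularGaugeGroup G]

/-- **`repr` ON THE GIBBS TOWER SUMS TO THE DRESSED INTEGRAL.**  Weights `A t τ := Zrun · ∫_{ev τ} e^{t·obsTower} d(tower
law)` of finitely many measurable, pairwise disjoint, covering term events sum to the Bałaban-normalised dressed integral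
of `ρ₀`. [folklore] -/
theorem sum_repr_eq_of_partition (D : FiniteEpsData F G) (hM : D.AvgMeasurable) (g₀ : ℕ → ℝ) (K : ℕ)
    (os : List (ULoop F)) {ι : Type*} (T : Finset ι) (ev : ι → Set (Tower (F.P K) G K))
    (hmeas : ∀ τ ∈ T, MeasurableSet (ev τ)) (hdisj : (↑T : Set ι).PairwiseDisjoint ev)
    (hcover : Set.univ ⊆ ⋃ τ ∈ T, ev τ) {A : ℝ → ι → ℝ}
    (hrepr : ∀ (t : ℝ), ∀ τ ∈ T, A t τ = Zrun D K (g₀ K) *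
      ∫ ω in ev τ, Real.exp (t * obsTower K os ω)
        ∂towerLaw (T4GenFunBounds.gibbsMeasure (F.P K) ((g₀ K)⁻¹ ^ 2)) (D.av K) K) (t : ℝ) :
    ∫ U, Real.exp (t * T4GenFunBounds.prodObs (D.scheme g₀) K os U) * D.dens K (g₀ K) 0 U ∂fieldMeasure (F.P K) 0 G =
      ∑ τ ∈ T, A t τ := by
  haveI := T4GenFunBounds.isProbabilityMeasure_gibbsMeasure (G := G) (F.P K) (sq_nonneg (g₀ K)⁻¹)
  haveI := isProbabilityMeasure_towerLaw (T4GenFunBounds.gibbsMeasure (F.P K) ((g₀ K)⁻¹ ^ 2)) (D.av K) (hM K) K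
  have hint : Integrable (fun ω => Real.exp (t * obsTower K os ω))
      (towerLaw (T4GenFunBounds.gibbsMeasure (F.P K) ((g₀ K)⁻¹ ^ 2)) (D.av K) K) :=
    T4GenFunBounds.integrable_exp_mul_of_bound (measurable_obsTower K os).aemeasurable
      (Filter.Eventually.of_forall (abs_obsTower_le_one K os)) t
  rw [integral_exp_mul_prodObs_dens_zero D hM g₀ K os t, Finset.sum_congr rfl (hrepr t), ← Finset.mul_sum,
    sum_setIntegral_eq_of_partition _ T ev hmeas hdisj hcover hint]

/-- **E1 FROM `repr` — THE BINDER `reprA` OF `ChessboardRoadWitness` ∕ `CountRoadWitnessT3b`, VERBATIM, AS A THEOREM** for a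
run whose per-cutoff states are the Gibbs towers of the data's own averagings at `β_K = (g₀ K)⁻²`, whose source observables
are `obsTower K os`, whose undressed partition functions are `Zrun D K (g₀ K)`, and whose term events PARTITION the tower
at every cutoff `K ≥ K₀` (measurable, pairwise disjoint, covering), with weights satisfying W4b′'s `repr` — the source
window `|t| ≤ l₀` and the threshold are not used.  Road W's E1 identity is a consequence of `repr`; nothing of Bałaban's
is asserted. [folklore] -/
theorem reprA_of_repr (D : FiniteEpsData F G) (hM : D.AvgMeasurable) (g₀ : ℕ → ℝ) (os : List (ULoop F)) {ι : Type*}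
    {T : ℕ → Finset ι} {ev : (K : ℕ) → ι → Set (Tower (F.P K) G K)} {K₀ : ℕ} {l₀ : ℝ}
    (hmeas : ∀ K, K₀ ≤ K → ∀ τ ∈ T K, MeasurableSet (ev K τ))
    (hdisj : ∀ K, K₀ ≤ K → (↑(T K) : Set ι).PairwiseDisjoint (ev K))
    (hcover : ∀ K, K₀ ≤ K → Set.univ ⊆ ⋃ τ ∈ T K, ev K τ) {A : ℕ → ℝ → ι → ℝ}
    (hrepr : ∀ K, K₀ ≤ K → ∀ (t : ℝ), ∀ τ ∈ T K, A K t τ = Zrun D K (g₀ K) *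
      ∫ ω in ev K τ, Real.exp (t * obsTower K os ω)
        ∂towerLaw (T4GenFunBounds.gibbsMeasure (F.P K) ((g₀ K)⁻¹ ^ 2)) (D.av K) K) :
    ∀ K t, |t| ≤ l₀ → K₀ ≤ K →
      ∫ U, Real.exp (t * T4GenFunBounds.prodObs (D.scheme g₀) K os U) * D.dens K (g₀ K) 0 U ∂fieldMeasure (F.P K) 0 G =
        ∑ τ ∈ T K, A K t τ :=
  fun K t _ hK => sum_repr_eq_of_partition D hM g₀ K os (T K) (ev K) (hmeas K hK) (hdisj K hK) (hcover K hK) (hrepr K hK) t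

/-- **E2 FROM `repr` — THE BINDER `reprB`, VERBATIM**: run B (cutoff `K + 1`, bare coupling `g₀ (K + 1)`, `K + 1` steps)
on the Gibbs tower of cutoff `K + 1`, term events indexed by `T K`. [folklore] -/
theorem reprB_of_repr (D : FiniteEpsData F G) (hM : D.AvgMeasurable) (g₀ : ℕ → ℝ) (os : List (ULoop F)) {ι : Type*}
    {T : ℕ → Finset ι} {ev' : (K : ℕ) → ι → Set (Tower (F.P (K + 1)) G (K + 1))} {K₀ : ℕ} {l₀ : ℝ}
    (hmeas : ∀ K, K₀ ≤ K → ∀ τ ∈ T K, MeasurableSet (ev' K τ))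
    (hdisj : ∀ K, K₀ ≤ K → (↑(T K) : Set ι).PairwiseDisjoint (ev' K))
    (hcover : ∀ K, K₀ ≤ K → Set.univ ⊆ ⋃ τ ∈ T K, ev' K τ) {A' : ℕ → ℝ → ι → ℝ}
    (hrepr : ∀ K, K₀ ≤ K → ∀ (t : ℝ), ∀ τ ∈ T K, A' K t τ = Zrun D (K + 1) (g₀ (K + 1)) *
      ∫ ω in ev' K τ, Real.exp (t * obsTower (K + 1) os ω)
        ∂towerLaw (T4GenFunBounds.gibbsMeasure (F.P (K + 1)) ((g₀ (K + 1))⁻¹ ^ 2)) (D.av (K + 1)) (K + 1)) :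
    ∀ K t, |t| ≤ l₀ → K₀ ≤ K →
      ∫ U, Real.exp (t * T4GenFunBounds.prodObs (D.scheme g₀) (K + 1) os U) * D.dens (K + 1) (g₀ (K + 1)) 0 U
          ∂fieldMeasure (F.P (K + 1)) 0 G = ∑ τ ∈ T K, A' K t τ :=
  fun K t _ hK => sum_repr_eq_of_partition D hM g₀ (K + 1) os (T K) (ev' K) (hmeas K hK) (hdisj K hK) (hcover K hK)
    (hrepr K hK) t

end Repr

/-! ## §5 Sanity: the one-term partition -/

namespace Sanity

variable {F : T4Family} {G : Type*} [GaugeGroup G] [MeasurableSpace G] [HaarData G] [RegularGaugeGroup G]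

/-- The binder shapes of §4 are JOINTLY INHABITED: one term with event `univ` at every cutoff and the weight DEFINED by
`repr` — E1 holds (here it reads `∫ e^{t·prodObs} ρ₀ = Zrun · ∫ e^{t·obsTower} d(tower law)`, i.e. §3). [folklore] -/
example (D : FiniteEpsData F G) (hM : D.AvgMeasurable) (g₀ : ℕ → ℝ) (os : List (ULoop F)) (l₀ : ℝ) :
    ∀ K t, |t| ≤ l₀ → 0 ≤ K →
      ∫ U, Real.exp (t * T4GenFunBounds.prodObs (D.scheme g₀) K os U) * D.dens K (g₀ K) 0 U ∂fieldMeasure (F.P K) 0 G =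
        ∑ τ ∈ ({()} : Finset Unit), (fun (K : ℕ) (t : ℝ) (_ : Unit) => Zrun D K (g₀ K) *
          ∫ ω in (Set.univ : Set (Tower (F.P K) G K)), Real.exp (t * obsTower K os ω)
            ∂towerLaw (T4GenFunBounds.gibbsMeasure (F.P K) ((g₀ K)⁻¹ ^ 2)) (D.av K) K) K t τ :=
  reprA_of_repr D hM g₀ os (T := fun _ => {()}) (ev := fun _ _ => Set.univ) (K₀ := 0)
    (fun _ _ _ _ => MeasurableSet.univ) (fun _ _ => by simp)
    (fun _ _ ω _ => Set.mem_iUnion₂.2 ⟨(), Finset.mem_singleton_self _, Set.mem_univ ω⟩) (fun _ _ _ _ _ => rfl)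

end Sanity

end

end Summit.QuantumFields.BalabanUV.T4Continuum.HistoryChessboardTowerRepr
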